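import Literature.AlgebraicGeometry.Frobenioids.ElementaryFrobenioid
import Mathlib.Data.PNat.Basic
import HarnessLib

/-!
# Frobenioids I, Proposition 1.5 (first step): the elementary Frobenioid `F_Φ` is a pre-Frobenioid
# (STEP-0 calibration fragment of the abc-iut cell — proof genre)

Mochizuki, *The geometry of Frobenioids I: the general theory*, Kyushu J. Math. **62** (2008)
293–400, §1, Proposition 1.5 "(Elementary Frobenioids are Frobenioids)", the first step of its
proof, kurims text p. 27 [cite: MochizukiFrdI2008, Prop. 1.5]:

> "Since `D` is a connected, totally epimorphic category, the fact that `F_Φ` is as well follows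
> immediately from the definition of the morphisms of `F_Φ` in Definition 1.1, (iii); the fact that
> a pre-divisorial monoid is integral [cf. Definition 1.1, (i)]; and the injectivity condition of
> Definition 1.1, (ii), (a). Thus, `F_Φ` is a pre-Frobenioid."

Here the pre-Frobenioid structure on `F_Φ` is "the natural functor `F_Φ → F_{Φ^char}`" induced by
`Φ → Φ^char`; its divisor monoid is `Φ^char`, which is divisorial because `Φ` is pre-divisorial
(Def. 1.1 (i)). We construct that functor, the zero section `D ⥤ F_Φ`, and prove:
`F_Φ` is totally epimorphic; `F_Φ` is connected; `Φ^char` is a (divisorial) monoid on `D`;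
hence `F_Φ → F_{Φ^char}` is a pre-Frobenioid. The remaining assertions of Proposition 1.5
(that `F_Φ` is a Frobenioid of Aut-ample, …, isotropic type; `O^▷(A) ≃ Φ(A)`; perfect /
group-like type) are NOT in this file. No statement of the paper is strengthened.
-/

namespace Literature.AlgebraicGeometry.Frobenioids

open CategoryTheory Opposite

universe w v u

variable {D : Type u} [Category.{v} D]

/-! ### Sharp monoids: `M → M^char` is injective; transfer of (characteristic) injectivity -/

/-- In a sharp monoid `N`, `Associates.mk : N → N^char` is injective. [cite: MochizukiFrdI2008, §0 p.11] -/
theorem associatesMk_injective_of_isSharp {N : Type u} [CommMonoid N] (hN : IsSharp N) :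
    Function.Injective (Associates.mk : N → Associates N) := by
  intro a b h
  obtain ⟨u, hu⟩ := Associates.mk_eq_mk_iff_associated.mp h
  rw [← hu, hN.1 u u.isUnit, mul_one]

/-- The map induced on characteristics by an injective map into a sharp monoid is injective.
[cite: MochizukiFrdI2008, §0 p.11] -/
theorem associatesMap_injective_of_isSharp {M N : Type u} [CommMonoid M] [CommMonoid N]
    (hN : IsSharp N) {f : M →* N} (hf : Function.Injective f) :
    Function.Injective (associatesMap f) := by
  intro x y h
  obtain ⟨a, rfl⟩ := Associates.mk_surjective x
  obtain ⟨b, rfl⟩ := Associates.mk_surjective y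
  rw [associatesMap_mk, associatesMap_mk] at h
  rw [hf (associatesMk_injective_of_isSharp hN h)]

/-- The map induced on characteristics by a surjective map is surjective. [cite: MochizukiFrdI2008, §0 p.11] -/
theorem associatesMap_surjective {M N : Type u} [CommMonoid M] [CommMonoid N] {f : M →* N}
    (hf : Function.Surjective f) : Function.Surjective (associatesMap f) := by
  intro y
  obtain ⟨b, rfl⟩ := Associates.mk_surjective y
  obtain ⟨a, rfl⟩ := hf b
  exact ⟨Associates.mk a, rfl⟩

/-! ### `Φ^char` is a divisorial monoid on `D` when `Φ` is a pre-divisorial monoid on `D` -/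

/-- The pull-back maps of `Φ^char` are the characteristics of those of `Φ`.
[cite: MochizukiFrdI2008, Def. 1.1(ii)] -/
theorem pull_charFunctor (Φ : Dᵒᵖ ⥤ CommMonCat.{w}) {A B : D} (α : B ⟶ A)
    (x : (charFunctor Φ).obj (op A)) :
    pull (charFunctor Φ) α x = associatesMap (pull Φ α) x := rfl

/-- If `Φ` is a monoid on `D` (Def. 1.1 (ii)) then so is `Φ^char`. [cite: MochizukiFrdI2008, Def. 1.1(ii)] -/
theorem isMonoidOn_charFunctor {Φ : Dᵒᵖ ⥤ CommMonCat.{w}} (hΦ : IsMonoidOn Φ) :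
    IsMonoidOn (charFunctor Φ) := by
  refine ⟨fun α => ?_, fun α hα => ?_⟩
  · -- (a): `(α^*)^char` is injective, and so is its own characteristic map
    have h1 : Function.Injective (pull (charFunctor Φ) α) := (hΦ.isCharInjective α).2
    exact ⟨h1, associatesMap_injective_of_isSharp isSharp_associates h1⟩
  · -- (b): a bijective `α^*` induces a bijective `(α^*)^char`
    exact ⟨(hΦ.isCharInjective α).2, associatesMap_surjective (hΦ.bijective_of_isFSM α hα).2⟩

/-- If `Φ` is pre-divisorial (objectwise) then `Φ^char` is divisorial (Def. 1.1 (i): "if `M` is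
pre-divisorial, then `M^char` is divisorial"). [cite: MochizukiFrdI2008, Def. 1.1(i)] -/
theorem isDivisorial_charFunctor {Φ : Dᵒᵖ ⥤ CommMonCat.{w}}
    (hΦ : Objectwise (fun M _ => IsPreDivisorial M) Φ) :
    Objectwise (fun M _ => IsDivisorial M) (charFunctor Φ) :=
  fun A => (hΦ A).isDivisorial_associates

/-! ### The natural functor `F_Φ → F_{Φ^char}` and the zero section `D → F_Φ` -/

namespace ElemFrobenioid

variable (Φ : Dᵒᵖ ⥤ CommMonCat.{w})

/-- The zero-divisor component of `toChar` is compatible with composition: in `Φ(A)^char`,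
`[φ^*(Z_ψ) · Z_φ^n] = (φ^*)^char [Z_ψ] · [Z_φ]^n`. [cite: MochizukiFrdI2008, Prop. 1.5] -/
private theorem mk_pull_mul_pow {A B : D} (f : A ⟶ B) (y : Φ.obj (op B)) (x : Φ.obj (op A))
    (n : ℕ) : Associates.mk (pull Φ f y * x ^ n) =
      associatesMap (pull Φ f) (Associates.mk y) * Associates.mk x ^ n := by
  rw [associatesMap_mk, ← Associates.mk_pow, Associates.mk_mul_mk]

/-- "The natural functor `F_Φ → F_{Φ^char}`" (FrdI Prop. 1.5 (i)): identity on objects and base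
arrows, `Div ↦ Div mod units`, `deg_Fr` unchanged. [cite: MochizukiFrdI2008, Prop. 1.5] -/
def toChar : ElemFrobenioid Φ ⥤ ElemFrobenioid (charFunctor Φ) where
  obj A := of (charFunctor Φ) A.base
  map φ := ⟨φ.base, Associates.mk φ.div, φ.degFr⟩
  map_id _ := rfl
  map_comp φ ψ := Hom.ext rfl (mk_pull_mul_pow Φ φ.base ψ.div φ.div ψ.degFr) rfl

/-- In `Φ(X)`: `0 = f^*(0) + 1 · 0`, the zero-divisor bookkeeping of the zero section.
[cite: MochizukiFrdI2008, Prop. 1.5] -/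
private theorem one_eq_pull_one_mul {X Y : D} (f : X ⟶ Y) :
    (1 : Φ.obj (op X)) = pull Φ f (1 : Φ.obj (op Y)) * (1 : Φ.obj (op X)) ^ ((1 : ℕ+) : ℕ) := by
  rw [map_one, one_pow, mul_one]

/-- The zero section `D → F_Φ`, `f ↦ (f, 0, 1)` (used on p. 27 to see that `F_Φ` is connected).
[cite: MochizukiFrdI2008, Prop. 1.5] -/
def zeroSection : D ⥤ ElemFrobenioid Φ where
  obj A := of Φ A
  map f := homMk f 1 1
  map_id _ := rfl
  map_comp f _ := Hom.ext rfl (one_eq_pull_one_mul Φ f) (mul_one (1 : ℕ+)).symm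

variable {Φ}

/-- `Base ∘ toChar = Base`. [cite: MochizukiFrdI2008, Prop. 1.5] -/
@[simp] theorem base_toChar_map {A B : ElemFrobenioid Φ} (φ : A ⟶ B) :
    Hom.base ((toChar Φ).map φ) = φ.base := rfl

/-- `Div ∘ toChar = (Div mod units)`. [cite: MochizukiFrdI2008, Prop. 1.5] -/
@[simp] theorem div_toChar_map {A B : ElemFrobenioid Φ} (φ : A ⟶ B) :
    Hom.div ((toChar Φ).map φ) = Associates.mk φ.div := rfl

/-- `deg_Fr ∘ toChar = deg_Fr`. [cite: MochizukiFrdI2008, Prop. 1.5] -/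
@[simp] theorem degFr_toChar_map {A B : ElemFrobenioid Φ} (φ : A ⟶ B) :
    Hom.degFr ((toChar Φ).map φ) = φ.degFr := rfl

/-! ### `F_Φ` is totally epimorphic and connected (FrdI Prop. 1.5, proof, first step) -/

/-- "`F_Φ` is totally epimorphic": from total epimorphicity of `D`, integrality of the `Φ(A)` and
injectivity of the pull-back maps (FrdI Prop. 1.5, proof). [cite: MochizukiFrdI2008, Prop. 1.5] -/
theorem isTotallyEpimorphic (hD : IsTotallyEpimorphic D)
    (hint : ∀ A : D, IsIntegral (Φ.obj (op A)))
    (hinj : ∀ {A B : D} (α : B ⟶ A), Function.Injective (pull Φ α)) :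
    IsTotallyEpimorphic (ElemFrobenioid Φ) := by
  refine ⟨fun {A B} φ => ⟨fun {Z} ψ ψ' h => ?_⟩⟩
  have hb : Base φ ≫ Base ψ = Base φ ≫ Base ψ' := congrArg Hom.base h
  have hn : degFr φ * degFr ψ = degFr φ * degFr ψ' := congrArg Hom.degFr h
  have hd : pull Φ (Base φ) (Div ψ) * Div φ ^ (degFr ψ : ℕ) =
      pull Φ (Base φ) (Div ψ') * Div φ ^ (degFr ψ' : ℕ) := congrArg Hom.div h
  haveI := hD.epi (Base φ)
  have hn' : degFr ψ = degFr ψ' := mul_left_cancel hn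
  haveI : IsCancelMul (Φ.obj (op A.base)) := isIntegral_iff_isCancelMul.mp (hint A.base)
  rw [hn'] at hd
  exact Hom.ext ((cancel_epi (Base φ)).mp hb) (hinj _ (mul_right_cancel hd)) hn'

/-- "`F_Φ` is connected" (as `D` is): every object is in the image of the zero section
`D → F_Φ`, which transports zigzags. [cite: MochizukiFrdI2008, Prop. 1.5] -/
theorem isGraphConnected (hD : IsGraphConnected D) : IsGraphConnected (ElemFrobenioid Φ) := by
  obtain ⟨⟨A⟩, hz⟩ := hD
  exact ⟨⟨of Φ A⟩, fun X Y => zigzag_obj_of_zigzag (zeroSection Φ) (hz X.base Y.base)⟩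

/-- **FrdI Proposition 1.5, first step: "Thus, `F_Φ` is a pre-Frobenioid."** For a pre-divisorial
monoid `Φ` on a connected, totally epimorphic category `D`, the natural functor `F_Φ → F_{Φ^char}`
is a pre-Frobenioid structure on `F_Φ` with (divisorial) divisor monoid `Φ^char`.
[cite: MochizukiFrdI2008, Prop. 1.5] -/
theorem isPreFrobenioid_toChar (hΦ : IsMonoidOn Φ)
    (hpre : Objectwise (fun M _ => IsPreDivisorial M) Φ) (hDc : IsGraphConnected D)
    (hDe : IsTotallyEpimorphic D) : IsPreFrobenioid (charFunctor Φ) (toChar Φ) where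
  isMonoidOn := isMonoidOn_charFunctor hΦ
  isDivisorial := isDivisorial_charFunctor hpre
  isGraphConnected_base := hDc
  isTotallyEpimorphic_base := hDe
  isGraphConnected := isGraphConnected hDc
  isTotallyEpimorphic :=
    isTotallyEpimorphic hDe (fun A => (hpre A).isIntegral) fun α => (hΦ.isCharInjective α).1

end ElemFrobenioid

end Literature.AlgebraicGeometry.Frobenioids
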